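import Mathlib

/-!
# `SnSubsetDichotomy.ThresholdSubsetTriples`, line `SketchIdeator2` — stub `stub_twistFree_of_blocked`, certificate form

Crux `stmt-MatrixMultiplication-10882` (`Summit.MatrixMultiplication.MatrixMultiplication.Theses.SnSubsetDichotomy.
ThresholdSubsetTriples`), line `SketchIdeator2` (ℤ/3-triality: triples `(X, τXτ⁻¹, τ²Xτ⁻²)` with `τ³ = 1`),
registered stub `stub_twistFree_of_blocked`: if every twisted corner
`x₁x₁'⁻¹ τ (x₂x₂'⁻¹) τ (x₃x₃'⁻¹) τ = 1` of a host `K ⊆ S_n` is either trivial (`xᵢ = xᵢ'` for all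
`i`) or has a non-trivial quotient `xᵢxᵢ'⁻¹` in a blocking set `B`, and a sub-code `X ⊆ K` avoids `B`
as a quotient (`x x'⁻¹ ∈ B ⇒ x = x'` on `X`), then every twisted corner of `X` is trivial.

This file proves the stub through its FINITE CORE.  Once the six elements `xᵢ, xᵢ'` are fixed, the
statement is a propositional formula in six atoms — the equalities `eᵢ := (xᵢ = xᵢ')` and the
memberships `bᵢ := (xᵢxᵢ'⁻¹ ∈ B)`:

`((e₁ ∧ e₂ ∧ e₃) ∨ (b₁ ∧ ¬e₁) ∨ (b₂ ∧ ¬e₂) ∨ (b₃ ∧ ¬e₃)) → (b₁ → e₁) → (b₂ → e₂) → (b₃ → e₃) → e₁ ∧ e₂ ∧ e₃`.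

`core_decide` certifies this formula over `Bool` by `decide` (its 64-row truth table is the
certificate, checked by the kernel); `core` transports it to arbitrary decidable propositions through
`decide : Prop → Bool`; `stub_twistFree_of_blocked` instantiates the atoms (equality of permutations of
`Fin n` and membership in a `Finset` of them are decidable) after restricting the host hypothesis from
`K` to `X ⊆ K`.

An independent case-split proof of the same registered signature is
`Summit.MatrixMultiplication.MatrixMultiplication.Theorems.ThresholdSubsetTriples.stub_twistFree_of_blocked`
(file `SnSubsetDichotomyThresholdSubsetTriplesStubTwistFreeOfBlocked.lean`); this file lives in the
sub-namespace `TwistFreeOfBlockedK12` and imports nothing from it.  Deliberately NOT here: anything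
about the host design (`stub_blockedHosts`), the deletion step or the TPP transfer — other stubs of the
line.
-/

namespace Summit.MatrixMultiplication.MatrixMultiplication.Theorems.ThresholdSubsetTriples.TwistFreeOfBlockedK12

/-- **Finite core, certified.**  The propositional skeleton of `stub_twistFree_of_blocked` as a
Boolean tautology in the six atoms `e₁ e₂ e₃` (standing for the equalities `xᵢ = xᵢ'`) and
`b₁ b₂ b₃` (standing for the memberships `xᵢxᵢ'⁻¹ ∈ B`): "trivial-or-blocked", together with
"blocked quotients force equality" at each coordinate, forces "trivial".  Proved by `decide`, i.e. by
the kernel evaluating all `2⁶ = 64` assignments.  (The Boolean connectives are bracketed to the right so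
that `simp` turns them into the right-nested `∧`/`∨` of the propositional form.) [folklore] -/
theorem core_decide : ∀ e₁ e₂ e₃ b₁ b₂ b₃ : Bool,
    ((e₁ && (e₂ && e₃)) || ((b₁ && !e₁) || ((b₂ && !e₂) || (b₃ && !e₃)))) = true →
    (b₁ = true → e₁ = true) → (b₂ = true → e₂ = true) → (b₃ = true → e₃ = true) →
    e₁ = true ∧ e₂ = true ∧ e₃ = true := by
  decide

/-- **Finite core, transported to decidable propositions.**  For decidable propositions
`E₁ E₂ E₃ B₁ B₂ B₃`: if `(E₁ ∧ E₂ ∧ E₃) ∨ (B₁ ∧ ¬E₁) ∨ (B₂ ∧ ¬E₂) ∨ (B₃ ∧ ¬E₃)` and `Bᵢ → Eᵢ` for each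
`i`, then `E₁ ∧ E₂ ∧ E₃`.  Obtained from `core_decide` at the truth values `decide Eᵢ`, `decide Bᵢ`.
[folklore] -/
theorem core {E₁ E₂ E₃ B₁ B₂ B₃ : Prop} [Decidable E₁] [Decidable E₂] [Decidable E₃]
    [Decidable B₁] [Decidable B₂] [Decidable B₃]
    (h : (E₁ ∧ E₂ ∧ E₃) ∨ (B₁ ∧ ¬E₁) ∨ (B₂ ∧ ¬E₂) ∨ (B₃ ∧ ¬E₃))
    (h₁ : B₁ → E₁) (h₂ : B₂ → E₂) (h₃ : B₃ → E₃) : E₁ ∧ E₂ ∧ E₃ := by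
  have hcore := core_decide (decide E₁) (decide E₂) (decide E₃) (decide B₁) (decide B₂) (decide B₃)
    (by simpa using h) (by simpa using h₁) (by simpa using h₂) (by simpa using h₃)
  simpa using hcore

/-- **Stub `stub_twistFree_of_blocked` — blocked host ⇒ twisted-corner-free sub-code** (registered
stub of line `SketchIdeator2`, crux `SnSubsetDichotomy.ThresholdSubsetTriples`,
stmt-MatrixMultiplication-10882; certificate form).  If every solution in `K⁶` of the twisted corner
equation `x₁x₁'⁻¹ τ (x₂x₂'⁻¹) τ (x₃x₃'⁻¹) τ = 1` is trivial or has a non-trivial quotient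
`xᵢxᵢ'⁻¹ ∈ B`, and `X ⊆ K` avoids `B` as a quotient, then every solution in `X⁶` is trivial.
Proof: restrict the host hypothesis to `X` and apply the decided core `core` to the six atoms
`xᵢ = xᵢ'`, `xᵢxᵢ'⁻¹ ∈ B`. [folklore] -/
theorem stub_twistFree_of_blocked : ∀ (n : ℕ) (τ : Equiv.Perm (Fin n)) (K B X : Finset (Equiv.Perm (Fin n))), X ⊆ K → (∀ x₁ ∈ K, ∀ x₁' ∈ K, ∀ x₂ ∈ K, ∀ x₂' ∈ K, ∀ x₃ ∈ K, ∀ x₃' ∈ K, x₁ * x₁'⁻¹ * τ * (x₂ * x₂'⁻¹) * τ * (x₃ * x₃'⁻¹) * τ = 1 → (x₁ = x₁' ∧ x₂ = x₂' ∧ x₃ = x₃') ∨ (x₁ * x₁'⁻¹ ∈ B ∧ x₁ ≠ x₁') ∨ (x₂ * x₂'⁻¹ ∈ B ∧ x₂ ≠ x₂') ∨ (x₃ * x₃'⁻¹ ∈ B ∧ x₃ ≠ x₃')) → (∀ x ∈ X, ∀ x' ∈ X, x * x'⁻¹ ∈ B → x = x') → ∀ x₁ ∈ X, ∀ x₁'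 ∈ X, ∀ x₂ ∈ X, ∀ x₂' ∈ X, ∀ x₃ ∈ X, ∀ x₃' ∈ X, x₁ * x₁'⁻¹ * τ * (x₂ * x₂'⁻¹) * τ * (x₃ * x₃'⁻¹) * τ = 1 → x₁ = x₁' ∧ x₂ = x₂' ∧ x₃ = x₃' := by
  intro n τ K B X hXK hK hA x₁ h₁ x₁' h₁' x₂ h₂ x₂' h₂' x₃ h₃ x₃' h₃' heq
  exact core (hK x₁ (hXK h₁) x₁' (hXK h₁') x₂ (hXK h₂) x₂' (hXK h₂') x₃ (hXK h₃) x₃' (hXK h₃') heq)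
    (hA x₁ h₁ x₁' h₁') (hA x₂ h₂ x₂' h₂') (hA x₃ h₃ x₃' h₃')

end Summit.MatrixMultiplication.MatrixMultiplication.Theorems.ThresholdSubsetTriples.TwistFreeOfBlockedK12
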